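import Summits.CriticalPhenomena.PercolationContinuityZ3.Theorems.PercNearOneGluingNoHeavyPcintKernSymZ6B5Check1
import HarnessLib

/-!
# PCINT lane: `p_c^bond(ℤ⁶) ≥ 0.0925` (kernel-checked B3r window certificate, memory 5 (4-step windows, 20736 codes); printed best lower bound 0.09183 (Noonan 1998)).

Cell `prim-pcint`, seat `prim-pcint-2` (gen 2); memo `run/shared/lean/prim/pcint/INTERVAL-PLAN.md` §14.  Does NOT build on p205010.
Assembles the kernel-checked chunks (`…KernZ6B5Check1..1`) and applies the generic certificate theorem
`WinK.le_criticalProb_of_checkBK` (`…PcintWinKernelCert`).  No external certificate, no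
`native_decide`; axioms standard.  (The lane's two-implementation certificates reach further at larger memory; this is the kernel-only row.)
-/

namespace Summit.CriticalPhenomena.PercolationContinuityZ3.Theorems.Pcint

open Literature.Probability.Percolation Literature.Probability.LatticeModels Z6B5

/-- **`p_c^bond(ℤ⁶) ≥ 0.0925`** (kernel-checked B3r window certificate, memory 5 (4-step windows, 20736 codes); printed best lower bound 0.09183 (Noonan 1998)). [folklore] -/
theorem criticalProb_Z6_ge_00925 : (0.0925 : ℝ) ≤ criticalProb (zdGraph 6) 0 := by
  have h := WinK.le_criticalProb_of_checkBK (d := 6) (m := 3) (pn := 925) (R := 10043) (S := 9958) (lamN := 99999)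
      (tbl := tbl) (dflt := 89051) (vlo := 89051) (vhi := 100000) (by norm_num) (by norm_num) (by norm_num) (by norm_num)
      (by norm_num) (by norm_num) (by norm_num) (by norm_num) tbl_bounds (by norm_num) (by norm_num) chkFile_1
  have e : ((925 : ℕ) : ℝ) / 10 ^ 4 = 0.0925 := by norm_num
  rw [e] at h
  exact h

end Summit.CriticalPhenomena.PercolationContinuityZ3.Theorems.Pcint
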